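import Summits.Ventures.PercRepro.Night2LocalD2R14SixZeroF

/-!
# PercRepro — the six-element columns of R1₄ without a far preimage, part G: one coloop, the faces (night-2, gen 16)

The cell `κ = 1`: `z` is the only coloop of `S` besides `y`.  The basis `S ∖ {z, y}` is not a member
(`notMem_membersIn_of_coloop_basis`), so at most four bases spread (`card_spreading_le_four`); a face `S ∖ {x, z'}`
of a spreading basis `S ∖ {x, y}` with `z' ≠ z` that is a member is a pair preimage (`face_mem_pairPre`); and the
spread part is at most `(4/25 + 8/175 + (4/175)·p₅)/(|G ∖ S| + 1)` with `p₅` the number of pair preimages of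
`|G ∖ cl B| ≥ 5` (`r14Spread_le_of_one_coloop`).
-/

namespace PercRepro.Shadow

open Finset PerFlat ThmH

variable {α : Type*} [DecidableEq α] {M : Matroid α} [M.Finite]

open scoped Classical in
/-- The basis `S ∖ {z, y}` at a coloop `z` of `S` is not a member (it has rank `3`). -/
theorem notMem_membersIn_of_coloop_basis {G : Finset α} (hG : G ∈ flatsQ M (4 + 1)) {y : α} (hyG : y ∈ G)
    (hyc : y ∉ clF M (G.erase y)) {S : Finset α} (hS : S ∈ shadowAt M (4 + 2) 4 (Uq M (4 + 2) 4) G) {z : α}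
    (hzS : z ∈ S) (hzy : z ≠ y) (hz : z ∉ clF M (S.erase z)) :
    (S.erase y).erase z ∉ membersIn M (Uq M (4 + 2) 4) G := by
  intro hmem
  have hGg : G ⊆ gr M := (mem_flatsQ.1 hG).1
  have hSG : S ⊆ G := subset_of_mem_shadowAt hS
  have hyS : y ∈ S := mem_of_mem_shadowAt_of_coloop (by rw [rkN_erase_eq_of_coloop hG hyG hyc]) hS
  have hU : (S.erase y).erase z ∈ Uq M (4 + 2) 4 := (mem_membersIn.1 hmem).1
  have hr4 := rkN_eq_of_mem_Uq hU
  have hsub : (S.erase y).erase z ⊆ S.erase z := by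
    intro e he
    rw [Finset.mem_erase, Finset.mem_erase] at he
    exact Finset.mem_erase.2 ⟨he.1, he.2.2⟩
  have h1 := rkN_insert_coloop_eq (hSG.trans hGg) hzS hz hsub
  have hsub2 : insert z ((S.erase y).erase z) ⊆ G.erase y := by
    intro e he
    rw [Finset.mem_insert] at he
    rcases he with rfl | he
    · exact Finset.mem_erase.2 ⟨hzy, hSG hzS⟩
    · rw [Finset.mem_erase, Finset.mem_erase] at he
      exact Finset.mem_erase.2 ⟨he.2.1, hSG he.2.2⟩
  have h2 := rkN_insert_coloop_eq hGg hyG hyc hsub2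
  have hSeq : insert y (insert z ((S.erase y).erase z)) = S := by
    rw [Finset.insert_erase (Finset.mem_erase.2 ⟨hzy, hzS⟩), Finset.insert_erase hyS]
  rw [hSeq, rkN_eq_five_of_mem_shadowAt hS] at h2
  omega

open scoped Classical in
/-- A spreading basis `B` (a member with `|G ∖ cl B| = 1`, `|B| < 5`, `S = insert x (B ∪ (G ∖ cl B))` for some
`x ∈ S`) has its `x` in `cl B ∖ B`. -/
theorem exists_mem_clF_sdiff_of_spreading {G : Finset α} (hG : G ∈ flatsQ M (4 + 1)) {y : α} (hyG : y ∈ G)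
    (hyc : y ∉ clF M (G.erase y)) (hP : ∀ z ∈ G.erase y, 4 ≤ rkN M ((G.erase y).erase z)) {S : Finset α}
    (hS : S ∈ shadowAt M (4 + 2) 4 (Uq M (4 + 2) 4) G) (h6 : S.card = 6) {B : Finset α}
    (hBm : B ∈ membersIn M (Uq M (4 + 2) 4) G) (hm1 : (G \ clF M B).card = 1)
    (hB5 : ¬ 5 ≤ B.card) (hex : ∃ x ∈ S, S = insert x (B ∪ (G \ clF M B))) :
    ∃ x, x ∈ clF M B \ B ∧ S = insert x (B ∪ (G \ clF M B)) := by
  have hSG : S ⊆ G := subset_of_mem_shadowAt hS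
  obtain ⟨x, hxS, hSx⟩ := hex
  have hBU : B ∈ Uq M (4 + 2) 4 := (mem_membersIn.1 hBm).1
  have hBG : B ⊆ G := (subset_clF hBU).trans (mem_membersIn.1 hBm).2
  have hyB : y ∉ B := by
    intro hyB
    have := two_le_card_sdiff_clF_of_mem_coloop hG hyG hyc hP hBm hyB
    omega
  have hGy : G \ clF M B = {y} := sdiff_clF_eq_singleton_of_subset_erase hG hyG hyc hBm
    (fun e he => Finset.mem_erase.2 ⟨fun h => hyB (h ▸ he), hBG he⟩)
  refine ⟨x, ?_, hSx⟩
  rw [hGy] at hSx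
  rw [Finset.mem_sdiff]
  have hxG : x ∈ G := hSG hxS
  refine ⟨?_, ?_⟩
  · by_contra h
    have : x ∈ G \ clF M B := Finset.mem_sdiff.2 ⟨hxG, h⟩
    rw [hGy, Finset.mem_singleton] at this
    subst this
    have h1 : S = insert x B := by rw [hSx]; ext e; simp
    have := Finset.card_insert_le x B
    rw [← h1] at this
    omega
  · intro hxB
    have h1 : S = B ∪ {y} := by
      rw [hSx]
      exact Finset.insert_eq_of_mem (Finset.mem_union_left _ hxB)
    have := Finset.card_union_le B {y}
    rw [← h1, Finset.card_singleton] at this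
    omega

open scoped Classical in
/-- With a coloop `z` of `S` (besides `y`), at most four bases spread at `|S| = 6`. -/
theorem card_spreading_le_four {G : Finset α} (hG : G ∈ flatsQ M (4 + 1)) {y : α} (hyG : y ∈ G)
    (hyc : y ∉ clF M (G.erase y)) (hP : ∀ z ∈ G.erase y, 4 ≤ rkN M ((G.erase y).erase z)) {S : Finset α}
    (hS : S ∈ shadowAt M (4 + 2) 4 (Uq M (4 + 2) 4) G) (h6 : S.card = 6) {z : α} (hzS : z ∈ S) (hzy : z ≠ y)
    (hz : z ∉ clF M (S.erase z)) :
    (((membersIn M (Uq M (4 + 2) 4) G).filter (fun B => (G \ clF M B).card = 1 ∧ ¬ 5 ≤ B.card)).filter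
      (fun B => ∃ x ∈ S, S = insert x (B ∪ (G \ clF M B)))).card ≤ 4 := by
  have hyS : y ∈ S := mem_of_mem_shadowAt_of_coloop (by rw [rkN_erase_eq_of_coloop hG hyG hyc]) hS
  set 𝓑 := ((membersIn M (Uq M (4 + 2) 4) G).filter (fun B => (G \ clF M B).card = 1 ∧ ¬ 5 ≤ B.card)).filter
    (fun B => ∃ x ∈ S, S = insert x (B ∪ (G \ clF M B))) with h𝓑def
  have key : ∀ B ∈ 𝓑, ∃ x ∈ (S.erase y).erase z, S \ (B ∪ {y}) = {x} ∧ B = (S.erase y).erase x := by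
    intro B hB
    rw [h𝓑def, Finset.mem_filter, Finset.mem_filter] at hB
    obtain ⟨⟨hBm, hm1, hB5⟩, hex⟩ := hB
    obtain ⟨x, hx, hSx⟩ := exists_mem_clF_sdiff_of_spreading hG hyG hyc hP hS h6 hBm hm1 hB5 hex
    obtain ⟨hGy, hyB, hxB, hxy, hB4, hSx'⟩ := basis_facts_of_six hG hyG hyc hP h6 hBm hm1 hx hSx
    have hxS : x ∈ S := by rw [hSx']; exact Finset.mem_insert_self _ _
    have hBeq : B = (S.erase y).erase x := by
      ext e
      rw [Finset.mem_erase, Finset.mem_erase, hSx', Finset.mem_insert, Finset.mem_union, Finset.mem_singleton]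
      constructor
      · intro he
        exact ⟨fun h => hxB (h ▸ he), fun h => hyB (h ▸ he), Or.inr (Or.inl he)⟩
      · rintro ⟨hex, hey, h⟩
        rcases h with h | h | h
        · exact absurd h hex
        · exact h
        · exact absurd h hey
    refine ⟨x, ?_, ?_, hBeq⟩
    · rw [Finset.mem_erase, Finset.mem_erase]
      refine ⟨?_, hxy, hxS⟩
      intro hxz
      subst hxz
      exact notMem_membersIn_of_coloop_basis hG hyG hyc hS hzS hzy hz (hBeq ▸ hBm)
    · rw [hSx', Finset.insert_sdiff_of_notMem _ (by
        rw [Finset.mem_union, Finset.mem_singleton, not_or]; exact ⟨hxB, hxy⟩), Finset.sdiff_self,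
        Finset.insert_empty]
  have hmaps : ∀ B ∈ 𝓑, S \ (B ∪ {y}) ∈ Finset.powersetCard 1 ((S.erase y).erase z) := by
    intro B hB
    obtain ⟨x, hx, hxeq, -⟩ := key B hB
    rw [Finset.mem_powersetCard, hxeq]
    exact ⟨Finset.singleton_subset_iff.2 hx, Finset.card_singleton _⟩
  have hinj : Set.InjOn (fun B => S \ (B ∪ {y})) (𝓑 : Set (Finset α)) := by
    intro B hB B' hB' h
    obtain ⟨x, -, hxeq, hBeq⟩ := key B (Finset.mem_coe.1 hB)
    obtain ⟨x', -, hxeq', hBeq'⟩ := key B' (Finset.mem_coe.1 hB')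
    have h' : S \ (B ∪ {y}) = S \ (B' ∪ {y}) := h
    rw [hxeq, hxeq'] at h'
    rw [hBeq, hBeq', Finset.singleton_inj.1 h']
  have h1 := Finset.card_le_card_of_injOn (fun B => S \ (B ∪ {y})) hmaps hinj
  rw [Finset.card_powersetCard, Nat.choose_one_right, Finset.card_erase_of_mem (Finset.mem_erase.2 ⟨hzy, hzS⟩),
    Finset.card_erase_of_mem hyS, h6] at h1
  exact h1

open scoped Classical in
/-- With `z` the only coloop of `S` besides `y`: a face `S ∖ {x, z'}` (`z' ≠ z`) of the basis `S ∖ {x, y}` that is a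
member is a pair preimage. -/
theorem face_mem_pairPre_of_one_coloop {G : Finset α} (hG : G ∈ flatsQ M (4 + 1)) {y : α} (hyG : y ∈ G)
    (hyc : y ∉ clF M (G.erase y)) {S : Finset α} (hS : S ∈ shadowAt M (4 + 2) 4 (Uq M (4 + 2) 4) G) {z : α}
    (hone : ∀ z' ∈ S, z' ≠ y → z' ∉ clF M (S.erase z') → z' = z) {x : α} (hxS : x ∈ S) (hxy : x ≠ y) (hxz : x ≠ z)
    {B : Finset α} (hBeq : B = (S.erase y).erase x) (hGy : G \ clF M B = {y}) {z' : α} (hz'B : z' ∈ B) (hz'z : z' ≠ z)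
    (hF : (B.erase z') ∪ (G \ clF M B) ∈ membersIn M (Uq M (4 + 2) 4) G) :
    (B.erase z') ∪ (G \ clF M B) ∈ pairPre M 4 G S := by
  have hGg : G ⊆ gr M := (mem_flatsQ.1 hG).1
  have hSG : S ⊆ G := subset_of_mem_shadowAt hS
  have hyS : y ∈ S := mem_of_mem_shadowAt_of_coloop (by rw [rkN_erase_eq_of_coloop hG hyG hyc]) hS
  rw [hBeq, Finset.mem_erase, Finset.mem_erase] at hz'B
  obtain ⟨hz'x, hz'y, hz'S⟩ := hz'B
  set F := (B.erase z') ∪ (G \ clF M B) with hFdef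
  have hFeq : F = (S.erase x).erase z' := by
    rw [hFdef, hGy, hBeq]
    ext e
    simp only [Finset.mem_union, Finset.mem_erase, Finset.mem_singleton]
    constructor
    · rintro (⟨hez, hex, hey, heS⟩ | rfl)
      · exact ⟨hez, hex, heS⟩
      · exact ⟨hz'y.symm, hxy.symm, hyS⟩
    · rintro ⟨hez, hex, heS⟩
      by_cases hey : e = y
      · exact Or.inr hey
      · exact Or.inl ⟨hez, hex, hey, heS⟩
  have hFU : F ∈ Uq M (4 + 2) 4 := (mem_membersIn.1 hF).1
  have hFg : F ⊆ gr M := by rw [hFeq]; exact ((Finset.erase_subset _ _).trans (Finset.erase_subset _ _)).trans (hSG.trans hGg)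
  have hr5 := rkN_eq_five_of_mem_shadowAt hS
  -- `x ∉ cl F` (else `z'` would be a coloop of `S`)
  have hxF : x ∉ clF M F := by
    intro hx
    have h1 := rkN_insert_le_of_mem_clF (M := M) hFg hx
    have h2 : insert x F = S.erase z' := by
      rw [hFeq]
      ext e
      simp only [Finset.mem_insert, Finset.mem_erase]
      constructor
      · rintro (rfl | ⟨hez, -, heS⟩)
        · exact ⟨hz'x.symm, hxS⟩
        · exact ⟨hez, heS⟩
      · rintro ⟨hez, heS⟩
        by_cases hex : e = x
        · exact Or.inl hex
        · exact Or.inr ⟨hez, hex, heS⟩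
    rw [h2, rkN_eq_of_mem_Uq hFU] at h1
    have hz'c : z' ∉ clF M (S.erase z') := by
      intro hz'
      have h3 := rkN_insert_le_of_mem_clF (M := M) ((Finset.erase_subset _ _).trans (hSG.trans hGg)) hz'
      rw [Finset.insert_erase hz'S, hr5] at h3
      omega
    exact hz'z (hone z' hz'S hz'y hz'c)
  -- `z' ∉ cl F` (else `x` would be a coloop of `S`)
  have hz'F : z' ∉ clF M F := by
    intro hz'
    have h1 := rkN_insert_le_of_mem_clF (M := M) hFg hz'
    have h2 : insert z' F = S.erase x := by
      rw [hFeq]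
      ext e
      simp only [Finset.mem_insert, Finset.mem_erase]
      constructor
      · rintro (rfl | ⟨-, hex, heS⟩)
        · exact ⟨hz'x, hz'S⟩
        · exact ⟨hex, heS⟩
      · rintro ⟨hex, heS⟩
        by_cases hez : e = z'
        · exact Or.inl hez
        · exact Or.inr ⟨hez, hex, heS⟩
    rw [h2, rkN_eq_of_mem_Uq hFU] at h1
    have hxc : x ∉ clF M (S.erase x) := by
      intro hx
      have h3 := rkN_insert_le_of_mem_clF (M := M) ((Finset.erase_subset _ _).trans (hSG.trans hGg)) hx
      rw [Finset.insert_erase hxS, hr5] at h3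
      omega
    exact hxz (hone x hxS hxy hxc)
  rw [mem_pairPre]
  refine ⟨hF, {x, z'}, ?_, ?_⟩
  · rw [Finset.mem_powersetCard]
    refine ⟨?_, Finset.card_pair hz'x.symm⟩
    intro e he
    rw [Finset.mem_insert, Finset.mem_singleton] at he
    rw [Finset.mem_sdiff]
    rcases he with rfl | rfl
    · exact ⟨hSG hxS, hxF⟩
    · exact ⟨hSG hz'S, hz'F⟩
  · rw [hFeq]
    ext e
    simp only [Finset.mem_union, Finset.mem_erase, Finset.mem_insert, Finset.mem_singleton]
    constructor
    · intro heS
      by_cases hex : e = x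
      · exact Or.inr (Or.inl hex)
      by_cases hez : e = z'
      · exact Or.inr (Or.inr hez)
      exact Or.inl ⟨hez, hex, heS⟩
    · rintro (⟨-, -, heS⟩ | rfl | rfl)
      · exact heS
      · exact hxS
      · exact hz'S

end PercRepro.Shadow
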